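import Literature.Computability.MetaComplexity.DPReconstructionK
import Literature.Computability.MetaComplexity.LanguageCompression
import HarnessLib

/-!
# Complexity meta: the two programs of Hirahara's Thm. 5.2 (weak symmetry of information)

Topic `Literature/Computability/MetaComplexity`. Machine layer of the proof of Hirahara 2021, Thm. 5.2
(ECCC TR21-058, p. 30), which analyses the `Gap(K vs K)` algorithm `A` of Lemma 5.1 on the inputs
`(DP_k(x; z) · w; 1^{2t}; 1ˢ)`:

* **the test** fed to Thm. 3.12: `DP (ω; r) ↦ A(ω r; 1^T, 1ˢ)`, here the polynomial-time language
  `WSOIProg.testLang L_A = {⟨⟨1^T, ⟨s⟩₂⟩, y⟩ | ⟨y, 1^T, 1^{min(s, |y|)}⟩ ∈ L_A}` for a separator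
  `L_A ∈ P` of `Gap_τ(K vs K)` (`testMap`, `testMap_apply`, `testLang_mem_P`, `boolPair_mem_testLang`);
* **the description of `DP_k(x; z) · w`** ("`DP_k(x; z) · w` can be described using `m, d ∈ ℕ`, `z`, and
  [a program for `x w`]", p. 30): the polynomial-time function `WSOIProg.gD U` which, on
  `⟨1^R 0 u, ⟨⟨n, k, t⟩₂, z ‖ prog⟩⟩`, runs the universal machine on `prog` for `t` steps (`runOpt`, from
  `UniversalMachine.polyTime`), splits the result `x ‖ w`, and outputs `z ‖ GL_k(x, z) ‖ w = DP_k(x; z) ‖ w`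
  (`gD_apply`, `gD_mem_FP`; lengths `length_payloadD`, `length_numsD_le`), to be fed to the ruler
  device `UniversalMachine.exists_ktAt_le_of_FP` (`KtViaRuler.lean`).

## References

* S. Hirahara, ECCC TR21-058 (2021), Thm. 5.2 and its proof (p. 30), Lemma 5.1, Def. 2.5.
-/

noncomputable section

namespace Literature.Computability.MetaComplexity

open _root_.Computability Polynomial Complexity Complexity.Brick Complexity.Plumb Complexity.OracleCompose Complexity.HashBricks
open Literature.Computability.Cryptography Cryptography.CondRed

namespace WSOIProg

/-! ### The test -/

/-- `⟨⟨1^T, bs⟩, y⟩ ↦ ⟨y, ⟨1^T, 1^{min(⟦bs⟧, |y|)}⟩⟩` (the `Gap(K vs K)` instance of `y` with the threshold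
read in binary under the ruler `1^{|y|}`). [cite: Hirahara2021, Thm. 5.2 (proof)] -/
def testMap : List Bool → List Bool :=
  fanoutFn sndF (fanoutFn (fstF ∘ fstF) (binToUnaryFn ∘ fanoutFn (onesFn ∘ sndF) (sndF ∘ fstF)))

/-- Value of `testMap`. [folklore] -/
theorem testMap_apply (T : ℕ) (bs y : List Bool) :
    testMap (boolPair (boolPair (ones T) bs) y) = boolPair y (boolPair (ones T) (ones (min (bitsToNat bs) y.length))) := by
  simp only [testMap, fanoutFn_apply, Function.comp_apply, sndF_boolPair, fstF_boolPair, onesFn_eq_ones, binToUnaryFn_boolPair,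
    List.length_replicate]

/-- `testMap ∈ FP`. [folklore] -/
theorem testMap_mem_FP : testMap ∈ FP :=
  fanoutFn_mem_FP sndF_mem_FP (fanoutFn_mem_FP (comp_mem_FP fstF_mem_FP fstF_mem_FP)
    (comp_mem_FP binToUnaryFn_mem_FP (fanoutFn_mem_FP (comp_mem_FP onesFn_mem_FP sndF_mem_FP) (comp_mem_FP sndF_mem_FP fstF_mem_FP))))

/-- **The test language** of a separator `L_A`. [cite: Hirahara2021, Thm. 5.2 (proof)] -/
def testLang (LA : Language Bool) : Language Bool := testMap ⁻¹' LA

/-- Membership in the test language. [folklore] -/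
theorem boolPair_mem_testLang (LA : Language Bool) (T : ℕ) (bs y : List Bool) :
    boolPair (boolPair (ones T) bs) y ∈ testLang LA ↔ boolPair y (boolPair (ones T) (ones (min (bitsToNat bs) y.length))) ∈ LA := by
  show testMap (boolPair (boolPair (ones T) bs) y) ∈ LA ↔ _
  rw [testMap_apply]

/-- The test language is in `P` for `L_A ∈ P`. [folklore] -/
theorem testLang_mem_P {LA : Language Bool} (hLA : LA ∈ Classes.P) : testLang LA ∈ Classes.P :=
  preimage_mem_P hLA testMap_mem_FP

/-! ### The description program of `DP_k(x; z) · w` -/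

section Descr

variable (U : UniversalMachine)

/-- The universal machine as a total string function `⟨prog, u⟩ ↦ optEnc (run prog |u|)`
(`none ↦ 0`, `some y ↦ 1 y`). [folklore] -/
def runOpt : List Bool → List Bool := fun w =>
  ((encodingList Bool).optionBool).encode (U.run (boolUnpair w).1 (boolUnpair w).2.length)

/-- `runOpt ∈ FP` (`UniversalMachine.polyTime` through `mem_FP_of_unaryArg`). [folklore] -/
theorem runOpt_mem_FP : runOpt U ∈ FP := mem_FP_of_unaryArg U.polyTime

/-- `runOpt` on a pair, as a tagged word. [folklore] -/
theorem runOpt_boolPair (prog u : List Bool) :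
    runOpt U (boolPair prog u) = (match U.run prog u.length with | none => [false] | some y => true :: y) := by
  simp only [runOpt, boolUnpair_boolPair]
  cases U.run prog u.length <;> rfl

/-- The numerals `⟨n, k, t⟩₂`. [folklore] -/
def numsD (n k t : ℕ) : List Bool := boolPair (encodeNat n) (boolPair (encodeNat k) (encodeNat t))

/-- The payload `⟨⟨n, k, t⟩₂, z ‖ prog⟩`. [folklore] -/
def payloadD (n k t : ℕ) (z prog : List Bool) : List Bool := boolPair (numsD n k t) (z ++ prog)

/-- Length of the payload. [folklore] -/
theorem length_payloadD (n k t : ℕ) (z prog : List Bool) :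
    (payloadD n k t z prog).length = 2 * (numsD n k t).length + 2 + z.length + prog.length := by
  simp only [payloadD, length_boolPair, List.length_append]; ring

/-- Length of the numerals. [folklore] -/
theorem length_numsD_le {n k t B : ℕ} (hn : n ≤ B) (hk : k ≤ B) (ht : t ≤ B) : (numsD n k t).length ≤ 5 * (Nat.log 2 B + 1) + 4 := by
  have := DPKProg.length_encodeNat_le_of_le hn
  have := DPKProg.length_encodeNat_le_of_le hk
  have := DPKProg.length_encodeNat_le_of_le ht
  simp only [numsD, length_boolPair]
  omega

/-- The ruler `1^R`. [folklore] -/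
def rulerF : List Bool → List Bool := onesPrefixFn ∘ fstF
/-- `nums`. [folklore] -/
def numsF : List Bool → List Bool := fstF ∘ sndF
/-- `1ⁿ`. [folklore] -/
def nU : List Bool → List Bool := binToUnaryFn ∘ fanoutFn rulerF (nthF 0 ∘ numsF)
/-- `1ᵏ`. [folklore] -/
def kU : List Bool → List Bool := binToUnaryFn ∘ fanoutFn rulerF (nthF 1 ∘ numsF)
/-- `1ᵗ`. [folklore] -/
def tU : List Bool → List Bool := binToUnaryFn ∘ fanoutFn rulerF (sndPow 1 ∘ numsF)
/-- `1^{kn}`. [folklore] -/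
def knU : List Bool → List Bool := umulFn ∘ fanoutFn kU nU
/-- `z ‖ prog`. [folklore] -/
def zprogF : List Bool → List Bool := sndF ∘ sndF
/-- `z`. [folklore] -/
def zF : List Bool → List Bool := takeFn ∘ fanoutFn knU zprogF
/-- `prog`. [folklore] -/
def progF : List Bool → List Bool := dropFn ∘ fanoutFn knU zprogF
/-- `y = U(prog, 1ᵗ)` (tag dropped; `ε` on no output). [folklore] -/
def yF : List Bool → List Bool := dropFn ∘ fanoutFn (fun _ => ones 1) (runOpt U ∘ fanoutFn progF tU)
/-- `x = y ↾ n`. [folklore] -/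
def xF : List Bool → List Bool := takeFn ∘ fanoutFn nU (yF U)
/-- `w = y ⇂ n`. [folklore] -/
def wF : List Bool → List Bool := dropFn ∘ fanoutFn nU (yF U)
/-- `GL_k(x, z)`. [folklore] -/
def glF : List Bool → List Bool := L53Prog.glFn ∘ fanoutFn (fanoutFn kU nU) (fanoutFn (xF U) zF)
/-- **The description program**: `z ‖ GL_k(x, z) ‖ w = DP_k(x; z) ‖ w`. [cite: Hirahara2021, Thm. 5.2 (proof)] -/
def gD : List Bool → List Bool := concatFn ∘ fanoutFn (concatFn ∘ fanoutFn zF (glF U)) (wF U)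

variable {U}

/-- **Value of the description program** on `⟨expPad 1 u, ⟨⟨n,k,t⟩₂, z ‖ prog⟩⟩` when `prog` prints `x ‖ w`
within `t` steps (`|x| = n`, `|z| = kn`, numerals below the ruler). [cite: Hirahara2021, Thm. 5.2 (proof)] -/
theorem gD_apply {u : List Bool} {n k t : ℕ} {x w z prog : List Bool} (hx : x.length = n) (hz : z.length = k * n)
    (hrun : U.run prog t = some (x ++ w)) (hn : n ≤ 2 ^ u.length) (hk : k ≤ 2 ^ u.length) (ht : t ≤ 2 ^ u.length) :
    gD U (boolPair (expPad 1 u) (payloadD n k t z prog)) = dpGen k x z ++ w := by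
  set z₀ := boolPair (expPad 1 u) (payloadD n k t z prog) with hz₀
  have hruler : rulerF z₀ = ones (2 ^ u.length) := by
    simp only [rulerF, hz₀, Function.comp_apply, fstF_boolPair, expPad, pow_one]
    exact onesPrefixFn_ones_append _ _
  have hnums : numsF z₀ = numsD n k t := by simp only [numsF, hz₀, payloadD, Function.comp_apply, sndF_boolPair, fstF_boolPair]
  have hnU : nU z₀ = ones n := by
    simp only [nU, Function.comp_apply, fanoutFn_apply, hruler, hnums, numsD, nthF_zero_boolPair, DPKProg.binToUnary_ruler hn]
  have hkU : kU z₀ = ones k := by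
    simp only [kU, Function.comp_apply, fanoutFn_apply, hruler, hnums, numsD, nthF_succ_boolPair, nthF_zero_boolPair, DPKProg.binToUnary_ruler hk]
  have htU : tU z₀ = ones t := by
    simp only [tU, Function.comp_apply, fanoutFn_apply, hruler, hnums, numsD, sndPow_succ_boolPair, sndPow_zero_boolPair, DPKProg.binToUnary_ruler ht]
  have hkn : knU z₀ = ones (k * n) := by simp only [knU, Function.comp_apply, fanoutFn_apply, hkU, hnU, umulFn_boolPair]
  have hzprog : zprogF z₀ = z ++ prog := by simp only [zprogF, hz₀, payloadD, Function.comp_apply, sndF_boolPair]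
  have hzF : zF z₀ = z := by
    simp only [zF, Function.comp_apply, fanoutFn_apply, hkn, hzprog, takeFn_boolPair, List.length_replicate]
    exact List.take_left' hz
  have hprogF : progF z₀ = prog := by
    simp only [progF, Function.comp_apply, fanoutFn_apply, hkn, hzprog, dropFn_boolPair, List.length_replicate]
    exact List.drop_left' hz
  have hy : yF U z₀ = x ++ w := by
    simp only [yF, Function.comp_apply, fanoutFn_apply, hprogF, htU, runOpt_boolPair, List.length_replicate, hrun, dropFn_boolPair]
    rfl
  have hxF : xF U z₀ = x := by
    simp only [xF, Function.comp_apply, fanoutFn_apply, hnU, hy, takeFn_boolPair, List.length_replicate]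
    exact List.take_left' hx
  have hwF : wF U z₀ = w := by
    simp only [wF, Function.comp_apply, fanoutFn_apply, hnU, hy, dropFn_boolPair, List.length_replicate]
    exact List.drop_left' hx
  have hgl : glF U z₀ = glBits k n x z := by
    simp only [glF, Function.comp_apply, fanoutFn_apply, hkU, hnU, hxF, hzF, L53Prog.glFn_boolPair]
  simp only [gD, Function.comp_apply, fanoutFn_apply, hzF, hgl, hwF, concatFn_boolPair]
  subst hx
  rfl

variable (U)

/-- **`gD U ∈ FP`.** [cite: Hirahara2021, Thm. 5.2 (proof)] -/
theorem gD_mem_FP : gD U ∈ FP := by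
  have hruler : rulerF ∈ FP := comp_mem_FP onesPrefixFn_mem_FP fstF_mem_FP
  have hnums : numsF ∈ FP := comp_mem_FP fstF_mem_FP sndF_mem_FP
  have hn : nU ∈ FP := comp_mem_FP binToUnaryFn_mem_FP (fanoutFn_mem_FP hruler (comp_mem_FP (nthF_mem_FP 0) hnums))
  have hk : kU ∈ FP := comp_mem_FP binToUnaryFn_mem_FP (fanoutFn_mem_FP hruler (comp_mem_FP (nthF_mem_FP 1) hnums))
  have ht : tU ∈ FP := comp_mem_FP binToUnaryFn_mem_FP (fanoutFn_mem_FP hruler (comp_mem_FP (sndPow_mem_FP 1) hnums))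
  have hkn : knU ∈ FP := comp_mem_FP umulFn_mem_FP (fanoutFn_mem_FP hk hn)
  have hzprog : zprogF ∈ FP := comp_mem_FP sndF_mem_FP sndF_mem_FP
  have hz : zF ∈ FP := comp_mem_FP takeFn_mem_FP (fanoutFn_mem_FP hkn hzprog)
  have hprog : progF ∈ FP := comp_mem_FP dropFn_mem_FP (fanoutFn_mem_FP hkn hzprog)
  have hy : yF U ∈ FP := comp_mem_FP dropFn_mem_FP (fanoutFn_mem_FP (const_mem_FP _) (comp_mem_FP (runOpt_mem_FP U) (fanoutFn_mem_FP hprog ht)))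
  have hx : xF U ∈ FP := comp_mem_FP takeFn_mem_FP (fanoutFn_mem_FP hn hy)
  have hw : wF U ∈ FP := comp_mem_FP dropFn_mem_FP (fanoutFn_mem_FP hn hy)
  have hgl : glF U ∈ FP := comp_mem_FP L53Prog.glFn_mem_FP (fanoutFn_mem_FP (fanoutFn_mem_FP hk hn) (fanoutFn_mem_FP hx hz))
  exact comp_mem_FP concatFn_mem_FP (fanoutFn_mem_FP (comp_mem_FP concatFn_mem_FP (fanoutFn_mem_FP hz hgl)) hw)

/-- **The description bound**: `K^{q(2^{|u|}+|payload|)}(DP_k(x; z) ‖ w) ≤ |⟨⟨n,k,t⟩₂, z ‖ prog⟩| + 2|u| + c_D`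
whenever `prog` prints `x ‖ w` within `t` steps and the numerals are below the ruler `2^{|u|}`.
[Hirahara 2021 (ECCC TR21-058), proof of Thm. 5.2 ("`DP_k(x; z) · w` can be described using `m, d`,
`z` and …")] [cite: Hirahara2021, Thm. 5.2 (proof)] -/
theorem exists_ktAt_dpGen_append_le :
    ∃ (cD : ℕ) (qD : Polynomial ℕ), ∀ (u : List Bool) (n k t : ℕ) (x w z prog : List Bool), x.length = n → z.length = k * n →
      U.run prog t = some (x ++ w) → n ≤ 2 ^ u.length → k ≤ 2 ^ u.length → t ≤ 2 ^ u.length →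
      U.ktAt (qD.eval (2 ^ u.length + (payloadD n k t z prog).length)) (dpGen k x z ++ w) ≤
        (payloadD n k t z prog).length + 2 * u.length + cD := by
  obtain ⟨cD, qD, h⟩ := U.exists_ktAt_le_of_FP (gD_mem_FP U)
  refine ⟨cD, qD, fun u n k t x w z prog hx hz hrun hn hk ht => ?_⟩
  have := h u (payloadD n k t z prog)
  rwa [gD_apply hx hz hrun hn hk ht] at this

end Descr

end WSOIProg

end Literature.Computability.MetaComplexity

end
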